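import Literature.Topology.FourManifolds.SimplifiedBrokenLefschetzHeight
import Literature.Topology.FourManifolds.SimplifiedBrokenLefschetzCaps
import Literature.Topology.FourManifolds.SlabMorseCount
import Literature.AlgebraicTopology.SingularHomology.MayerVietorisEuler
import Mathlib.Analysis.Normed.Module.Connected
import HarnessLib

/-!
# Baykur's Euler count: a genus-`(h+1)` SBLF of a homotopy 4-sphere has `4h` Lefschetz points

Topic `Literature/Topology/FourManifolds`.  This file DISCHARGES the named fact
`card_eq_four_mul_of_sblf_of_homotopyEquiv_sphere_four` of `SimplifiedBrokenLefschetzFibration.lean`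
(Baykur 2012, Lemma 7, read on a homotopy 4-sphere: *"the Euler characteristic of `X` can be
also computed as the sum `e(X) = 2 - 2(g-1) + 2 - 2g + k`, … On the other hand `e(X) = 2`"*),
assembling the preceding files: normalise the round image to the equator
(`SimplifiedBrokenLefschetzRoundImage.lean`), tilt the height `Λ_ε = v₂ + ε v₀`, cut `X` at four
regular levels into two polar cap pieces (`χ =` the fibre Euler characteristics `2 - 2(h+1)`,
`2 - 2h`, `SimplifiedBrokenLefschetzCaps.lean`), two collars and the middle slab (Morse count,
`SlabMorseCount.lean`, with the local analysis of `SimplifiedBrokenLefschetzHeight.lean`), and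
compare the Mayer–Vietoris sum with `e(X) = 2` for the two signs of `ε`.  Everything here is
**proved**; no definitions, no new named facts.

## References

* R. İ. Baykur, *Broken Lefschetz fibrations and smooth structures on 4-manifolds*,
  Geom. Topol. Monogr. 18 (2012), Lemma 7. [Baykur2012]
* A. Hatcher, *Algebraic Topology* (2002), §2.2 (Mayer–Vietoris, Thm. 2.44). [HatcherAT2002]
-/

noncomputable section

open scoped Manifold ContDiff Topology RealInnerProductSpace EuclideanSpace
open Set Function Filter
open Literature.AlgebraicTopology.SingularHomology Literature.AlgebraicTopology.Homotopy

namespace Literature.Topology.FourManifolds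

universe u

namespace IsSimplifiedBrokenLefschetzFibration

variable {X : Type u} [TopologicalSpace X] [T2Space X] [SecondCountableTopology X]
  [CompactSpace X] [ChartedSpace (EuclideanSpace ℝ (Fin 4)) X] [IsManifold (𝓡 4) ∞ X]
  {o : SmoothOrientation (𝓡 4) X} {f : X → Metric.sphere (0 : EuclideanSpace ℝ (Fin 3)) 1}
  {L : Finset X} {h : ℕ}

/-! ### Punctured open hemispheres are preconnected -/

omit [T2Space X] [SecondCountableTopology X] [CompactSpace X] [IsManifold (𝓡 4) ∞ X] in
/-- **An open hemisphere `{± v₂ > 0}` minus finitely many points is preconnected**: it is the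
image of the plane minus finitely many points under the central (gnomonic) parametrisation
`(a, b) ↦ (a, b, ±1)/‖(a, b, ±1)‖`, and the plane minus a countable set is path connected.
[folklore] -/
theorem isPreconnected_hemisphere_diff {s : ℝ} (hs : s = 1 ∨ s = -1)
    {T : Set (Metric.sphere (0 : EuclideanSpace ℝ (Fin 3)) 1)} (hT : T.Finite) :
    IsPreconnected ({v : Metric.sphere (0 : EuclideanSpace ℝ (Fin 3)) 1 |
      0 < s * (v : EuclideanSpace ℝ (Fin 3)) 2} \ T) := by
  have hs0 : s ≠ 0 := by rcases hs with rfl | rfl <;> norm_num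
  have hs2 : s * s = 1 := by rcases hs with rfl | rfl <;> norm_num
  -- the lift `a ↦ (a₀, a₁, s)` and its normalisation
  set u : EuclideanSpace ℝ (Fin 2) → EuclideanSpace ℝ (Fin 3) := fun a =>
    (a 0) • EuclideanSpace.single (0 : Fin 3) (1 : ℝ) + (a 1) • EuclideanSpace.single (1 : Fin 3) (1 : ℝ) +
      EuclideanSpace.single (2 : Fin 3) s
    with hu
  have hu0 : ∀ a, (u a) 0 = a 0 := fun a => by simp [hu]
  have hu1 : ∀ a, (u a) 1 = a 1 := fun a => by simp [hu]
  have hu2 : ∀ a, (u a) 2 = s := fun a => by simp [hu]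
  have hune : ∀ a, u a ≠ 0 := fun a h0 => by
    have := congrArg (fun x : EuclideanSpace ℝ (Fin 3) => x 2) h0
    rw [hu2] at this
    exact hs0 (by simpa using this)
  have hupos : ∀ a, 0 < ‖u a‖ := fun a => norm_pos_iff.2 (hune a)
  have hc0 : Continuous fun a : EuclideanSpace ℝ (Fin 2) => a 0 :=
    (EuclideanSpace.proj (0 : Fin 2)).continuous
  have hc1 : Continuous fun a : EuclideanSpace ℝ (Fin 2) => a 1 :=
    (EuclideanSpace.proj (1 : Fin 2)).continuous
  have hcont_u : Continuous u :=
    ((hc0.smul continuous_const).add (hc1.smul continuous_const)).add continuous_const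
  have hPmem : ∀ a, ‖u a‖⁻¹ • u a ∈ Metric.sphere (0 : EuclideanSpace ℝ (Fin 3)) 1 := fun a => by
    rw [mem_sphere_zero_iff_norm, norm_smul, norm_inv, norm_norm, inv_mul_cancel₀ (hupos a).ne']
  set P : EuclideanSpace ℝ (Fin 2) → Metric.sphere (0 : EuclideanSpace ℝ (Fin 3)) 1 := fun a =>
    ⟨‖u a‖⁻¹ • u a, hPmem a⟩ with hP
  have hPval : ∀ a, ((P a : Metric.sphere (0 : EuclideanSpace ℝ (Fin 3)) 1) :
      EuclideanSpace ℝ (Fin 3)) = ‖u a‖⁻¹ • u a := fun a => rfl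
  have hcontP : Continuous P :=
    ((hcont_u.norm.inv₀ fun a => (hupos a).ne').smul hcont_u).subtype_mk _
  have hPinj : Injective P := by
    intro a a' he
    have he' : ‖u a‖⁻¹ • u a = ‖u a'‖⁻¹ • u a' := congrArg Subtype.val he
    have h2 := congrArg (fun x : EuclideanSpace ℝ (Fin 3) => x 2) he'
    simp only [PiLp.smul_apply, smul_eq_mul, hu2] at h2
    have hr : ‖u a‖⁻¹ = ‖u a'‖⁻¹ := mul_right_cancel₀ hs0 h2
    have hr0 : ‖u a‖⁻¹ ≠ 0 := inv_ne_zero (hupos a).ne'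
    ext i; fin_cases i
    · have h0 := congrArg (fun x : EuclideanSpace ℝ (Fin 3) => x 0) he'
      simp only [PiLp.smul_apply, smul_eq_mul, hu0, ← hr] at h0
      exact mul_left_cancel₀ hr0 h0
    · have h1 := congrArg (fun x : EuclideanSpace ℝ (Fin 3) => x 1) he'
      simp only [PiLp.smul_apply, smul_eq_mul, hu1, ← hr] at h1
      exact mul_left_cancel₀ hr0 h1
  -- `P` maps onto the open hemisphere
  have hPrange : range P = {v : Metric.sphere (0 : EuclideanSpace ℝ (Fin 3)) 1 |
      0 < s * (v : EuclideanSpace ℝ (Fin 3)) 2} := by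
    ext v
    constructor
    · rintro ⟨a, rfl⟩
      show 0 < s * (‖u a‖⁻¹ • u a) 2
      rw [PiLp.smul_apply, smul_eq_mul, hu2, mul_comm, mul_assoc, hs2, mul_one]
      exact inv_pos.2 (hupos a)
    · intro hv
      have hv2 : (v : EuclideanSpace ℝ (Fin 3)) 2 ≠ 0 := by
        intro h0; rw [mem_setOf_eq, h0, mul_zero] at hv; exact lt_irrefl _ hv
      set a : EuclideanSpace ℝ (Fin 2) := EuclideanSpace.single 0
        (s * (v : EuclideanSpace ℝ (Fin 3)) 0 / (v : EuclideanSpace ℝ (Fin 3)) 2) +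
        EuclideanSpace.single 1
          (s * (v : EuclideanSpace ℝ (Fin 3)) 1 / (v : EuclideanSpace ℝ (Fin 3)) 2) with ha
      have hua : u a = (s / (v : EuclideanSpace ℝ (Fin 3)) 2) • (v : EuclideanSpace ℝ (Fin 3)) := by
        ext i; fin_cases i
        · show (u a) 0 = (s / (v : EuclideanSpace ℝ (Fin 3)) 2) * (v : EuclideanSpace ℝ (Fin 3)) 0
          rw [hu0]; simp [ha]; ring
        · show (u a) 1 = (s / (v : EuclideanSpace ℝ (Fin 3)) 2) * (v : EuclideanSpace ℝ (Fin 3)) 1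
          rw [hu1]; simp [ha]; ring
        · show (u a) 2 = (s / (v : EuclideanSpace ℝ (Fin 3)) 2) * (v : EuclideanSpace ℝ (Fin 3)) 2
          rw [hu2]; field_simp
      have hspos : 0 < s / (v : EuclideanSpace ℝ (Fin 3)) 2 := by
        have : 0 < s * (v : EuclideanSpace ℝ (Fin 3)) 2 := hv
        rw [div_eq_mul_inv]
        rcases hs with rfl | rfl
        · rw [one_mul] at this ⊢; exact inv_pos.2 this
        · have h' : (v : EuclideanSpace ℝ (Fin 3)) 2 < 0 := by linarith
          have := inv_lt_zero.2 h'
          linarith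
      refine ⟨a, Subtype.ext ?_⟩
      rw [hPval, hua, norm_smul, Real.norm_of_nonneg hspos.le, norm_eq_of_mem_sphere v, mul_one,
        smul_smul, inv_mul_cancel₀ hspos.ne', one_smul]
  -- the punctured plane is path connected
  have hrank : 1 < Module.rank ℝ (EuclideanSpace ℝ (Fin 2)) := by
    rw [← Module.finrank_eq_rank, finrank_euclideanSpace_fin]; norm_num
  have hcount : (P ⁻¹' T).Countable := (hT.preimage hPinj.injOn).countable
  have hconn := (hcount.isPathConnected_compl_of_one_lt_rank hrank).isConnected.isPreconnected
  have himage : P '' (P ⁻¹' T)ᶜ = {v : Metric.sphere (0 : EuclideanSpace ℝ (Fin 3)) 1 |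
      0 < s * (v : EuclideanSpace ℝ (Fin 3)) 2} \ T := by
    rw [← hPrange]
    ext v
    constructor
    · rintro ⟨a, ha, rfl⟩; exact ⟨⟨a, rfl⟩, ha⟩
    · rintro ⟨⟨a, rfl⟩, hv⟩; exact ⟨a, hv, rfl⟩
  rw [← himage]
  exact hconn.image P hcontP.continuousOn

/-! ### The fibres over the two hemispheres have genera `h + 1` and `h`, in some order -/

/-- **Euler characteristics of the fibres over the two hemispheres.**  For an SBLF with
equatorial round image on a closed 4-manifold and points `w₊`, `w₋` of the open upper and lower
hemispheres that are not Lefschetz values, `χ(f⁻¹w₊) + χ(f⁻¹w₋) = (2 - 2(h+1)) + (2 - 2h)`: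
by Ehresmann (`isFibreBundleWith_restrictPreimage`) the fibre genus is constant on each
hemisphere punctured at the Lefschetz values (preconnected,
`isPreconnected_hemisphere_diff`), the genus-`(h+1)` and genus-`h` regular values of
`IsSimplifiedBrokenLefschetzFibration.exists_higher/lower` lie in the two hemispheres, and they
cannot lie in the same one. [cite: Baykur2012, Lemma 7] -/
theorem finRelHomology_and_relEuler_fibre_add (hf : IsSimplifiedBrokenLefschetzFibration o f L h)
    (hC : f '' ({p : X | ¬ Surjective (mfderiv (𝓡 4) (𝓡 2) f p)} \ (↑L : Set X)) =
      sphereEquator 1)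
    {w₁ w₂ : Metric.sphere (0 : EuclideanSpace ℝ (Fin 3)) 1}
    (hw₁ : 0 < (w₁ : EuclideanSpace ℝ (Fin 3)) 2) (hw₂ : (w₂ : EuclideanSpace ℝ (Fin 3)) 2 < 0)
    (hw₁L : w₁ ∉ f '' (↑L : Set X)) (hw₂L : w₂ ∉ f '' (↑L : Set X)) :
    FinRelHomology ℤ ℤ ↥(f ⁻¹' {w₁}) ∅ 3 ∧ FinRelHomology ℤ ℤ ↥(f ⁻¹' {w₂}) ∅ 3 ∧
      relEuler ℤ ℤ ↥(f ⁻¹' {w₁}) ∅ + relEuler ℤ ℤ ↥(f ⁻¹' {w₂}) ∅ = 2 - 4 * (h : ℤ) := by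
  -- regular values: off the equator and off the Lefschetz values
  have hreg : ∀ v : Metric.sphere (0 : EuclideanSpace ℝ (Fin 3)) 1,
      (v : EuclideanSpace ℝ (Fin 3)) 2 ≠ 0 → v ∉ f '' (↑L : Set X) →
      ∀ q, f q = v → Surjective (mfderiv (𝓡 4) (𝓡 2) f q) := by
    intro v hv2 hvL q hq
    by_contra hq'
    by_cases hqL : q ∈ L
    · exact hvL ⟨q, Finset.mem_coe.2 hqL, hq⟩
    · have hmem : f q ∈ sphereEquator 1 := by
        rw [← hC]; exact mem_image_of_mem f ⟨hq', fun h' => hqL (Finset.mem_coe.1 h')⟩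
      rw [hq] at hmem
      exact hv2 ((mem_sphereEquator_iff v).1 hmem)
  -- the punctured hemispheres
  have hT : (f '' (↑L : Set X)).Finite := (L.finite_toSet).image f
  have hside : ∀ {s : ℝ}, s = 1 ∨ s = -1 →
      IsOpen ({v : Metric.sphere (0 : EuclideanSpace ℝ (Fin 3)) 1 |
          0 < s * (v : EuclideanSpace ℝ (Fin 3)) 2} \ f '' (↑L : Set X)) ∧
      IsPreconnected ({v : Metric.sphere (0 : EuclideanSpace ℝ (Fin 3)) 1 |
          0 < s * (v : EuclideanSpace ℝ (Fin 3)) 2} \ f '' (↑L : Set X)) ∧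
      (∀ v ∈ ({v : Metric.sphere (0 : EuclideanSpace ℝ (Fin 3)) 1 |
          0 < s * (v : EuclideanSpace ℝ (Fin 3)) 2} \ f '' (↑L : Set X)),
        ∀ q, f q = v → Surjective (mfderiv (𝓡 4) (𝓡 2) f q)) := by
    intro s hs
    refine ⟨?_, isPreconnected_hemisphere_diff hs hT, fun v hv => hreg v ?_ hv.2⟩
    · refine (isOpen_lt continuous_const (continuous_const.mul
        ((EuclideanSpace.proj (2 : Fin 3)).continuous.comp continuous_subtype_val))).sdiff
        hT.isClosed
    · intro h0
      have h1 := hv.1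
      rw [mem_setOf_eq, h0, mul_zero] at h1
      exact lt_irrefl _ h1
  -- genus clauses are constant on each punctured hemisphere
  have hconst : ∀ {s : ℝ}, s = 1 ∨ s = -1 →
      ∀ y y' : Metric.sphere (0 : EuclideanSpace ℝ (Fin 3)) 1,
      y ∈ ({v : Metric.sphere (0 : EuclideanSpace ℝ (Fin 3)) 1 |
          0 < s * (v : EuclideanSpace ℝ (Fin 3)) 2} \ f '' (↑L : Set X)) →
      y' ∈ ({v : Metric.sphere (0 : EuclideanSpace ℝ (Fin 3)) 1 |
          0 < s * (v : EuclideanSpace ℝ (Fin 3)) 2} \ f '' (↑L : Set X)) →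
      Nonempty (↥(f ⁻¹' {y'}) ≃ₜ ↥(f ⁻¹' {y})) := by
    intro s hs y y' hy hy'
    obtain ⟨hWo, hWc, hWreg⟩ := hside hs
    have hb := isFibreBundleWith_restrictPreimage hf.contMDiff hWo hWc hWreg hy
    obtain ⟨e⟩ := hb.nonempty_fibre_homeomorph ⟨y', hy'⟩
    -- the fibre of the restriction over `y'` is the fibre of `f` over `y'`
    have hemb : Topology.IsEmbedding (fun z : ↥((({v : Metric.sphere (0 : EuclideanSpace ℝ (Fin 3)) 1 |
        0 < s * (v : EuclideanSpace ℝ (Fin 3)) 2} \ f '' (↑L : Set X)).restrictPreimage f) ⁻¹'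
          {⟨y', hy'⟩}) => ((z : ↥(f ⁻¹' ({v : Metric.sphere (0 : EuclideanSpace ℝ (Fin 3)) 1 |
            0 < s * (v : EuclideanSpace ℝ (Fin 3)) 2} \ f '' (↑L : Set X)))) : X)) :=
      Topology.IsEmbedding.subtypeVal.comp Topology.IsEmbedding.subtypeVal
    have hrange : range (fun z : ↥((({v : Metric.sphere (0 : EuclideanSpace ℝ (Fin 3)) 1 |
        0 < s * (v : EuclideanSpace ℝ (Fin 3)) 2} \ f '' (↑L : Set X)).restrictPreimage f) ⁻¹'
          {⟨y', hy'⟩}) => ((z : ↥(f ⁻¹' ({v : Metric.sphere (0 : EuclideanSpace ℝ (Fin 3)) 1 |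
            0 < s * (v : EuclideanSpace ℝ (Fin 3)) 2} \ f '' (↑L : Set X)))) : X)) =
        f ⁻¹' {y'} := by
      ext x
      simp only [mem_range, mem_preimage, mem_singleton_iff]
      constructor
      · rintro ⟨z, rfl⟩
        exact congrArg Subtype.val (show (({v : Metric.sphere (0 : EuclideanSpace ℝ (Fin 3)) 1 |
          0 < s * (v : EuclideanSpace ℝ (Fin 3)) 2} \ f '' (↑L : Set X)).restrictPreimage f) z.1 =
            ⟨y', hy'⟩ from z.2)
      · intro hx
        have hxW : f x ∈ ({v : Metric.sphere (0 : EuclideanSpace ℝ (Fin 3)) 1 |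
            0 < s * (v : EuclideanSpace ℝ (Fin 3)) 2} \ f '' (↑L : Set X)) := hx ▸ hy'
        exact ⟨⟨⟨x, hxW⟩, Subtype.ext hx⟩, rfl⟩
    exact ⟨(hemb.toHomeomorph.trans (Homeomorph.setCongr hrange)).symm.trans e⟩
  -- transport of the genus clauses along homeomorphisms of fibres
  have htransp : ∀ {m : ℕ} {y y' : Metric.sphere (0 : EuclideanSpace ℝ (Fin 3)) 1},
      Nonempty (↥(f ⁻¹' {y'}) ≃ₜ ↥(f ⁻¹' {y})) →
      Nonempty ((Fin m → ℤ) ≃ₗ[ℤ] singularHomology ℤ ℤ ↥(f ⁻¹' {y}) 1) →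
      Nonempty ((Fin m → ℤ) ≃ₗ[ℤ] singularHomology ℤ ℤ ↥(f ⁻¹' {y'}) 1) := by
    rintro m y y' ⟨φ⟩ ⟨l⟩
    exact ⟨l.trans (singularHomology.mapIso ℤ ℤ φ 1).toLinearEquiv.symm⟩
  have hexcl : ∀ {y : Metric.sphere (0 : EuclideanSpace ℝ (Fin 3)) 1},
      Nonempty ((Fin (2 * (h + 1)) → ℤ) ≃ₗ[ℤ] singularHomology ℤ ℤ ↥(f ⁻¹' {y}) 1) →
      Nonempty ((Fin (2 * h) → ℤ) ≃ₗ[ℤ] singularHomology ℤ ℤ ↥(f ⁻¹' {y}) 1) → False := by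
    rintro y ⟨l₁⟩ ⟨l₂⟩
    have h1 := (l₂.trans l₁.symm).finrank_eq
    simp only [Module.finrank_fin_fun] at h1
    omega
  -- sides of the regular values
  have hside_of_reg : ∀ y : Metric.sphere (0 : EuclideanSpace ℝ (Fin 3)) 1,
      (∀ q, f q = y → Surjective (mfderiv (𝓡 4) (𝓡 2) f q)) →
      y ∈ ({v : Metric.sphere (0 : EuclideanSpace ℝ (Fin 3)) 1 |
          0 < (1 : ℝ) * (v : EuclideanSpace ℝ (Fin 3)) 2} \ f '' (↑L : Set X)) ∨
      y ∈ ({v : Metric.sphere (0 : EuclideanSpace ℝ (Fin 3)) 1 |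
          0 < (-1 : ℝ) * (v : EuclideanSpace ℝ (Fin 3)) 2} \ f '' (↑L : Set X)) := by
    intro y hy
    have hyL : y ∉ f '' (↑L : Set X) := by
      rintro ⟨p, hp, rfl⟩
      exact hf.not_surjective_mfderiv_of_mem (Finset.mem_coe.1 hp) (hy p rfl)
    have hy2 : (y : EuclideanSpace ℝ (Fin 3)) 2 ≠ 0 := by
      intro h0
      have hyC : y ∈ sphereEquator 1 := (mem_sphereEquator_iff y).2 h0
      rw [← hC] at hyC
      obtain ⟨q, ⟨hq, -⟩, hfq⟩ := hyC
      exact hq (hy q hfq)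
    rcases lt_or_gt_of_ne hy2 with hlt | hgt
    · right; exact ⟨by show 0 < (-1 : ℝ) * _; linarith, hyL⟩
    · left; exact ⟨by show 0 < (1 : ℝ) * _; linarith, hyL⟩
  have hw₁W : w₁ ∈ ({v : Metric.sphere (0 : EuclideanSpace ℝ (Fin 3)) 1 |
      0 < (1 : ℝ) * (v : EuclideanSpace ℝ (Fin 3)) 2} \ f '' (↑L : Set X)) :=
    ⟨by show 0 < (1 : ℝ) * _; linarith, hw₁L⟩
  have hw₂W : w₂ ∈ ({v : Metric.sphere (0 : EuclideanSpace ℝ (Fin 3)) 1 |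
      0 < (-1 : ℝ) * (v : EuclideanSpace ℝ (Fin 3)) 2} \ f '' (↑L : Set X)) :=
    ⟨by show 0 < (-1 : ℝ) * _; linarith, hw₂L⟩
  have hw₁reg := hreg w₁ hw₁.ne' hw₁L
  have hw₂reg := hreg w₂ hw₂.ne hw₂L
  -- the surfaces
  obtain ⟨F₁, _, _, _, _, _, _, _, e₁, φ₁, -, -, -, -, -, hfin₁, hχ₁⟩ :=
    hf.exists_oriented_surface_fibre hw₁reg
  obtain ⟨F₂, _, _, _, _, _, _, _, e₂, φ₂, -, -, -, -, -, hfin₂, hχ₂⟩ :=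
    hf.exists_oriented_surface_fibre hw₂reg
  refine ⟨hfin₁.of_homeomorph φ₁ (mapsTo_empty _ _) (mapsTo_empty _ _),
    hfin₂.of_homeomorph φ₂ (mapsTo_empty _ _) (mapsTo_empty _ _), ?_⟩
  rw [← relEuler_eq_of_homeomorph (R := ℤ) (M := ℤ) (A := (∅ : Set F₁)) φ₁ (mapsTo_empty _ _)
      (mapsTo_empty _ _),
    ← relEuler_eq_of_homeomorph (R := ℤ) (M := ℤ) (A := (∅ : Set F₂)) φ₂ (mapsTo_empty _ _)
      (mapsTo_empty _ _)]
  -- distribute the genera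
  obtain ⟨yh, hyh, hgh⟩ := hf.exists_higher
  obtain ⟨yl, hyl, hgl⟩ := hf.exists_lower
  have one_or : (1 : ℝ) = 1 ∨ (1 : ℝ) = -1 := Or.inl rfl
  have neg_or : (-1 : ℝ) = 1 ∨ (-1 : ℝ) = -1 := Or.inr rfl
  rcases hside_of_reg yh hyh with hyh₁ | hyh₂
  · -- genus `h + 1` above, so genus `h` below
    have hA₁ := htransp (hconst one_or yh w₁ hyh₁ hw₁W) hgh
    have hB₂ : Nonempty ((Fin (2 * h) → ℤ) ≃ₗ[ℤ] singularHomology ℤ ℤ ↥(f ⁻¹' {w₂}) 1) := by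
      rcases hside_of_reg yl hyl with hyl₁ | hyl₂
      · exact (hexcl (htransp (hconst one_or yh yl hyh₁ hyl₁) hgh) hgl).elim
      · exact htransp (hconst neg_or yl w₂ hyl₂ hw₂W) hgl
    rw [relEuler_eq_of_genus_clause hχ₁ φ₁ hA₁, relEuler_eq_of_genus_clause hχ₂ φ₂ hB₂]
    push_cast; ring
  · -- genus `h + 1` below, so genus `h` above
    have hA₂ := htransp (hconst neg_or yh w₂ hyh₂ hw₂W) hgh
    have hB₁ : Nonempty ((Fin (2 * h) → ℤ) ≃ₗ[ℤ] singularHomology ℤ ℤ ↥(f ⁻¹' {w₁}) 1) := by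
      rcases hside_of_reg yl hyl with hyl₁ | hyl₂
      · exact htransp (hconst one_or yl w₁ hyl₁ hw₁W) hgl
      · exact (hexcl (htransp (hconst neg_or yh yl hyh₂ hyl₂) hgh) hgl).elim
    rw [relEuler_eq_of_genus_clause hχ₁ φ₁ hB₁, relEuler_eq_of_genus_clause hχ₂ φ₂ hA₂]
    push_cast; ring

/-! ### Slabs, collars and levels of the tilted height -/

omit [IsManifold (𝓡 4) ∞ X] [T2Space X] [SecondCountableTopology X] [CompactSpace X]
  [ChartedSpace (EuclideanSpace ℝ (Fin 4)) X] in
/-- Absolute homology of a slab from the pair `(slab, bottom)` and the bottom level (exact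
sequence of the pair, Hatcher 2002, Thm. 2.44). [cite: HatcherAT2002, §2.2 Thm. 2.44] -/
theorem finRelHomology_and_relEuler_slab_abs {g : X → ℝ} {a b : ℝ} (hab : a ≤ b) {N : ℕ}
    (hslab : FinRelHomology ℤ ℤ ↥(g ⁻¹' Icc a b) (Subtype.val ⁻¹' (g ⁻¹' {a})) N)
    (hlev : FinRelHomology ℤ ℤ ↥(g ⁻¹' {a}) ∅ N) (hlevχ : relEuler ℤ ℤ ↥(g ⁻¹' {a}) ∅ = 0) :
    FinRelHomology ℤ ℤ ↥(g ⁻¹' Icc a b) ∅ N ∧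
      relEuler ℤ ℤ ↥(g ⁻¹' Icc a b) ∅ =
        relEuler ℤ ℤ ↥(g ⁻¹' Icc a b) (Subtype.val ⁻¹' (g ⁻¹' {a})) := by
  have hsub : g ⁻¹' {a} ⊆ g ⁻¹' Icc a b := fun x hx => by
    have hx' : g x = a := hx
    exact ⟨hx'.symm.le, hx'.le.trans hab⟩
  let eBot : ↥(Subtype.val ⁻¹' (g ⁻¹' {a}) : Set ↥(g ⁻¹' Icc a b)) ≃ₜ ↥(g ⁻¹' {a}) :=
    { toFun := fun z => ⟨(z.1 : X), z.2⟩
      invFun := fun x => ⟨⟨(x : X), hsub x.2⟩, x.2⟩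
      left_inv := fun z => rfl
      right_inv := fun x => rfl
      continuous_toFun := by fun_prop
      continuous_invFun := by fun_prop }
  have hAB : FinRelHomology ℤ ℤ ↥(Subtype.val ⁻¹' (g ⁻¹' {a}) : Set ↥(g ⁻¹' Icc a b))
      (Subtype.val ⁻¹' (∅ : Set ↥(g ⁻¹' Icc a b))) N := by
    rw [Set.preimage_empty]
    exact hlev.of_homeomorph eBot.symm (mapsTo_empty _ _) (mapsTo_empty _ _)
  obtain ⟨hP, hχ⟩ := FinRelHomology.triple_mid (empty_subset _) hAB hslab
  refine ⟨hP, ?_⟩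
  rw [hχ, Set.preimage_empty, ← relEuler_eq_of_homeomorph (R := ℤ) (M := ℤ) (A := (∅ : Set _))
    eBot.symm (mapsTo_empty _ _) (mapsTo_empty _ _), hlevχ, zero_add]

omit [IsManifold (𝓡 4) ∞ X] [T2Space X] [SecondCountableTopology X] [CompactSpace X]
  [ChartedSpace (EuclideanSpace ℝ (Fin 4)) X] in
/-- A subset `S ⊆ B` of `X`, seen inside `↥B`, is homeomorphic to `↥S`. [folklore] -/
theorem nonempty_homeomorph_preimage_val {S B : Set X} (hSB : S ⊆ B) :
    Nonempty (↥(Subtype.val ⁻¹' S : Set ↥B) ≃ₜ ↥S) :=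
  ⟨{ toFun := fun z => ⟨(z.1 : X), z.2⟩
     invFun := fun x => ⟨⟨(x : X), hSB x.2⟩, x.2⟩
     left_inv := fun z => rfl
     right_inv := fun x => rfl
     continuous_toFun := by fun_prop
     continuous_invFun := by fun_prop }⟩

/-! ### The Morse count between the caps equals `4h` -/

/-- **Baykur's Euler count for one tilted height.**  Let `f` be an SBLF with equatorial round
image on a closed 4-manifold `X` with `χ(X) = 2`, `Λ = Λ_ε` (`ε ≠ 0`), and levels
`|ε|, |Λ (f L)| ≤ b' < c₁ < c₂`, `c₂² < 1 + ε²`.  Then the signed Morse count of `Λ ∘ f` on the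
slab `-c₂ ≤ Λ ∘ f ≤ c₂` is `4h`:  Mayer–Vietoris for the cover of `X` by the lower cap piece
`{Λ ∘ f ≤ -c₁}` and `{-c₂ ≤ Λ ∘ f}`, and of the latter by the slab and the upper cap piece
`{c₁ ≤ Λ ∘ f}` (Hatcher 2002, §2.2), with: caps `χ = χ(fibre)` summing to `2 - 4h`
(`finRelHomology_and_relEuler_preimage_cap`, `finRelHomology_and_relEuler_fibre_add`), collars
and levels `χ = 0` (`finRelHomology_and_relEuler_slab_of_nondegenerate` without critical points,
`finRelHomology_and_relEuler_level`), slab `χ =` the Morse count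
(`finRelHomology_and_relEuler_slab_of_nondegenerate`), and `χ(X) = 2`.
[cite: Baykur2012, Lemma 7] [cite: HatcherAT2002, §2.2 Thm. 2.44] -/
theorem morseCount_height_eq_four_mul (hf : IsSimplifiedBrokenLefschetzFibration o f L h)
    (hC : f '' ({p : X | ¬ Surjective (mfderiv (𝓡 4) (𝓡 2) f p)} \ (↑L : Set X)) =
      sphereEquator 1)
    (hχX : relEuler ℤ ℤ X ∅ = 2) {ε : ℝ} (hε : ε ≠ 0)
    (Λ : EuclideanSpace ℝ (Fin 3) →L[ℝ] ℝ) (hΛ : ∀ x, Λ x = x 2 + ε * x 0) {b' c₁ c₂ : ℝ}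
    (hεb : |ε| ≤ b') (hLb : ∀ p ∈ L, |Λ (f p)| ≤ b') (hbc : b' < c₁) (hc₁₂ : c₁ < c₂)
    (hc₂ : c₂ ^ 2 < 1 + ε ^ 2) :
    ∑ k ∈ Finset.range 5, (-1 : ℤ) ^ k *
        ((criticalSetOfIndex (𝓡 4)
            ((fun w : Metric.sphere (0 : EuclideanSpace ℝ (Fin 3)) 1 => Λ w) ∘ f) k ∩
          ((fun w : Metric.sphere (0 : EuclideanSpace ℝ (Fin 3)) 1 => Λ w) ∘ f) ⁻¹' Ioo (-c₂) c₂).ncard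
            : ℤ) = 4 * (h : ℤ) := by
  set g : X → ℝ := (fun w : Metric.sphere (0 : EuclideanSpace ℝ (Fin 3)) 1 => Λ w) ∘ f with hgdef
  have hg : ContMDiff (𝓡 4) 𝓘(ℝ, ℝ) ∞ g := (contMDiff_apply_sphere Λ).comp hf.contMDiff
  have hgc : Continuous g := hg.continuous
  have hg_apply : ∀ x, g x = Λ (f x) := fun x => rfl
  -- the vector `n₀` of `Λ` and the poles
  obtain ⟨n₀, hn₀, hnorm⟩ := exists_inner_repr_height Λ hΛ
  set M : ℝ := ‖n₀‖ with hMdef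
  have hM0 : 0 < M := by
    have h1 : 0 < M ^ 2 := by rw [hMdef, hnorm]; positivity
    rcases (norm_nonneg n₀).lt_or_eq with h' | h'
    · exact h'
    · rw [hMdef, ← h'] at h1; norm_num at h1
  have hb'0 : 0 ≤ b' := (abs_nonneg ε).trans hεb
  have hc₁0 : 0 < c₁ := hb'0.trans_lt hbc
  have hc₂0 : 0 < c₂ := hc₁0.trans hc₁₂
  have hc₂M : c₂ < M := lt_of_pow_lt_pow_left₀ 2 hM0.le (by rw [hMdef, hnorm]; exact hc₂)
  have hbM : b' < M := hbc.trans (hc₁₂.trans hc₂M)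
  -- coordinates of `n₀`
  have hn₀2 : n₀ 2 = 1 := by
    rw [apply_eq_inner_single, real_inner_comm, ← hn₀, hΛ]; simp
  -- the poles
  have hpole_mem : M⁻¹ • n₀ ∈ Metric.sphere (0 : EuclideanSpace ℝ (Fin 3)) 1 := by
    rw [mem_sphere_zero_iff_norm, norm_smul, norm_inv, Real.norm_of_nonneg hM0.le,
      inv_mul_cancel₀ hM0.ne']
  have hpole_mem' : -(M⁻¹ • n₀) ∈ Metric.sphere (0 : EuclideanSpace ℝ (Fin 3)) 1 := by
    rw [mem_sphere_zero_iff_norm, norm_neg]; exact mem_sphere_zero_iff_norm.1 hpole_mem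
  set w₁ : Metric.sphere (0 : EuclideanSpace ℝ (Fin 3)) 1 := ⟨M⁻¹ • n₀, hpole_mem⟩ with hw₁
  set w₂ : Metric.sphere (0 : EuclideanSpace ℝ (Fin 3)) 1 := ⟨-(M⁻¹ • n₀), hpole_mem'⟩ with hw₂
  have hΛw₁ : Λ w₁ = M := by
    show Λ (M⁻¹ • n₀) = M
    rw [hn₀, real_inner_smul_right, real_inner_self_eq_norm_sq, ← hMdef]
    field_simp
  have hΛw₂ : Λ w₂ = -M := by
    show Λ (-(M⁻¹ • n₀)) = -M
    rw [map_neg]; exact congrArg Neg.neg hΛw₁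
  have hw₁2 : 0 < (w₁ : EuclideanSpace ℝ (Fin 3)) 2 := by
    show 0 < (M⁻¹ • n₀) 2
    rw [PiLp.smul_apply, smul_eq_mul, hn₀2, mul_one]; exact inv_pos.2 hM0
  have hw₂2 : (w₂ : EuclideanSpace ℝ (Fin 3)) 2 < 0 := by
    show (-(M⁻¹ • n₀)) 2 < 0
    rw [PiLp.neg_apply, PiLp.smul_apply, smul_eq_mul, hn₀2, mul_one, neg_lt_zero]
    exact inv_pos.2 hM0
  have hnotL : ∀ w : Metric.sphere (0 : EuclideanSpace ℝ (Fin 3)) 1, |Λ w| = M →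
      w ∉ f '' (↑L : Set X) := by
    rintro w hw ⟨p, hp, rfl⟩
    have := hLb p (Finset.mem_coe.1 hp)
    linarith
  have hw₁L : w₁ ∉ f '' (↑L : Set X) := hnotL w₁ (by rw [hΛw₁, abs_of_pos hM0])
  have hw₂L : w₂ ∉ f '' (↑L : Set X) := hnotL w₂ (by rw [hΛw₂, abs_neg, abs_of_pos hM0])
  obtain ⟨hF₁, hF₂, hχF⟩ := hf.finRelHomology_and_relEuler_fibre_add hC hw₁2 hw₂2 hw₁L hw₂L
  -- regular values of `f` above `b'`
  have hregΛ : ∀ v : Metric.sphere (0 : EuclideanSpace ℝ (Fin 3)) 1, b' < |Λ v| →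
      ∀ q, f q = v → Surjective (mfderiv (𝓡 4) (𝓡 2) f q) := by
    intro v hv
    by_contra hnreg
    rcases mem_image_or_abs_apply_le_of_not_regular hC Λ hΛ hnreg with ⟨p, hp, rfl⟩ | hle
    · exact lt_irrefl _ ((hLb p (Finset.mem_coe.1 hp)).trans_lt hv)
    · linarith
  -- the two cap pieces
  obtain ⟨hcap₁, hχcap₁⟩ := finRelHomology_and_relEuler_preimage_cap hf.contMDiff Λ hb'0 hbc
    (fun v hv => hregΛ v (hv.trans_le (le_abs_self _))) (w := w₁)
    (by rw [hΛw₁]; linarith) hF₁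
  obtain ⟨hcap₂, hχcap₂⟩ := finRelHomology_and_relEuler_preimage_cap hf.contMDiff (-Λ) hb'0 hbc
    (fun v hv => hregΛ v (by
      rw [neg_apply] at hv
      exact hv.trans_le (neg_le_abs _))) (w := w₂)
    (by rw [neg_apply, hΛw₂, neg_neg]; linarith) hF₂
  -- in terms of `g`
  have hcap₁' : FinRelHomology ℤ ℤ ↥(g ⁻¹' Ici c₁) ∅ 3 := hcap₁
  have hχcap₁' : relEuler ℤ ℤ ↥(g ⁻¹' Ici c₁) ∅ = relEuler ℤ ℤ ↥(f ⁻¹' {w₁}) ∅ := hχcap₁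
  have hAeq : f ⁻¹' {v : Metric.sphere (0 : EuclideanSpace ℝ (Fin 3)) 1 | c₁ ≤ (-Λ) v} =
      g ⁻¹' Iic (-c₁) := by
    ext x
    simp only [mem_preimage, mem_setOf_eq, neg_apply, mem_Iic, hg_apply]
    constructor <;> intro h' <;> linarith
  have hcap₂' : FinRelHomology ℤ ℤ ↥(g ⁻¹' Iic (-c₁)) ∅ 3 :=
    hcap₂.of_homeomorph (Homeomorph.setCongr hAeq) (mapsTo_empty _ _) (mapsTo_empty _ _)
  have hχcap₂' : relEuler ℤ ℤ ↥(g ⁻¹' Iic (-c₁)) ∅ = relEuler ℤ ℤ ↥(f ⁻¹' {w₂}) ∅ := by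
    rw [← relEuler_eq_of_homeomorph (R := ℤ) (M := ℤ) (A := (∅ : Set _)) (Homeomorph.setCongr hAeq)
      (mapsTo_empty _ _) (mapsTo_empty _ _), hχcap₂]
  -- critical values of `g`: small, or at the poles
  have hcritval : ∀ x, IsMCriticalPt (𝓡 4) g x → |g x| ≤ b' ∨ (g x) ^ 2 = 1 + ε ^ 2 := by
    intro x hx
    rcases isMCriticalPt_height_cases hf hC hε Λ hΛ hx with hxL | ⟨-, -, h1, h2⟩ | ⟨-, hsq⟩
    · exact Or.inl (hLb x hxL)
    · left
      have h0 : |((f x : Metric.sphere (0 : EuclideanSpace ℝ (Fin 3)) 1) :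
          EuclideanSpace ℝ (Fin 3)) 0| ≤ 1 := by
        have h3 := abs_real_inner_le_norm (EuclideanSpace.single (0 : Fin 3) (1 : ℝ))
          ((f x : Metric.sphere (0 : EuclideanSpace ℝ (Fin 3)) 1) : EuclideanSpace ℝ (Fin 3))
        rw [← apply_eq_inner_single, norm_eq_of_mem_sphere, PiLp.norm_single, norm_one,
          one_mul] at h3
        exact h3
      rw [hg_apply, hΛ, h2, zero_add, abs_mul]
      exact (mul_le_of_le_one_right (abs_nonneg ε) h0).trans hεb
    · exact Or.inr hsq
  have hregband : ∀ x, b' < |g x| → |g x| < M → ¬ IsMCriticalPt (𝓡 4) g x := by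
    intro x h1 h2 hx
    rcases hcritval x hx with h3 | h3
    · linarith
    · have h4 : |g x| ^ 2 < M ^ 2 := pow_lt_pow_left₀ h2 (abs_nonneg _) two_ne_zero
      rw [sq_abs, h3, hMdef, hnorm] at h4
      exact lt_irrefl _ h4
  have hnd : ∀ x, |g x| < M → IsMCriticalPt (𝓡 4) g x →
      (mhessian (𝓡 4) g x).Nondegenerate := by
    intro x h1 hx
    refine nondegenerate_height hf hC hε Λ hΛ hx fun h3 => ?_
    have h4 : |g x| ^ 2 < M ^ 2 := pow_lt_pow_left₀ h1 (abs_nonneg _) two_ne_zero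
    rw [sq_abs, hg_apply, h3, hMdef, hnorm] at h4
    exact lt_irrefl _ h4
  -- the width of the regular bands
  set δ : ℝ := min ((c₁ - b') / 2) ((M - c₂) / 2) with hδ
  have hδ0 : 0 < δ := lt_min (by linarith) (by linarith)
  have hδ1 : δ ≤ (c₁ - b') / 2 := min_le_left _ _
  have hδ2 : δ ≤ (M - c₂) / 2 := min_le_right _ _
  have hreg_of : ∀ x, c₁ - δ ≤ |g x| → |g x| ≤ c₂ + δ → ¬ IsMCriticalPt (𝓡 4) g x :=
    fun x h1 h2 => hregband x (by linarith) (by linarith)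
  -- bands `[lo, hi] ⊆ [c₁ - δ, c₂ + δ]` of `|g|` are regular
  have hreg_band : ∀ {lo hi : ℝ}, c₁ - δ ≤ lo → hi ≤ c₂ + δ → ∀ x,
      g x ∈ Icc (-hi) (-lo) ∪ Icc lo hi → ¬ IsMCriticalPt (𝓡 4) g x := by
    intro lo hi hlo hhi x hx
    have hlo0 : 0 < lo := by linarith
    rcases hx with ⟨h1, h2⟩ | ⟨h1, h2⟩
    · have hneg : g x < 0 := by linarith
      refine hreg_of x ?_ ?_ <;> rw [abs_of_neg hneg] <;> linarith
    · have hpos : 0 < g x := by linarith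
      refine hreg_of x ?_ ?_ <;> rw [abs_of_pos hpos] <;> linarith
  have three_pos : (1 : ℕ) ≤ 3 := by norm_num
  -- (i) the middle slab `[-c₂, c₂]`, relative to its bottom
  obtain ⟨hslab, hχslab⟩ := finRelHomology_and_relEuler_slab_of_nondegenerate (n := 3) three_pos
    hg (a := -c₂) (b := c₂) (by linarith) hδ0
    (fun x hx => by
      refine hreg_band (lo := c₂) (hi := c₂ + δ) (by linarith) le_rfl x ?_
      rcases hx with ⟨h1, h2⟩ | h'
      · exact Or.inl ⟨by linarith, by linarith⟩
      · exact Or.inr h')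
    (fun x hx hc => hnd x (abs_lt.2 ⟨by linarith [hx.1], by linarith [hx.2]⟩) hc)
  -- (ii) the lower collar `[-c₂, -c₁]`
  obtain ⟨hcol₁, hχcol₁⟩ := finRelHomology_and_relEuler_slab_of_nondegenerate (n := 3) three_pos
    hg (a := -c₂) (b := -c₁) (by linarith) hδ0
    (fun x hx => by
      rcases hx with ⟨h1, h2⟩ | ⟨h1, h2⟩
      · exact hreg_band (lo := c₂) (hi := c₂ + δ) (by linarith) le_rfl x
          (Or.inl ⟨by linarith, by linarith⟩)
      · exact hreg_band (lo := c₁ - δ) (hi := c₁) le_rfl (by linarith) x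
          (Or.inl ⟨by linarith, by linarith⟩))
    (fun x hx hc => absurd hc (hregband x
      (by rw [abs_of_neg (by linarith [hx.2])]; linarith [hx.2])
      (by rw [abs_of_neg (by linarith [hx.2])]; linarith [hx.1])))
  -- (iii) the upper collar `[c₁, c₂]`
  obtain ⟨hcol₂, hχcol₂⟩ := finRelHomology_and_relEuler_slab_of_nondegenerate (n := 3) three_pos
    hg (a := c₁) (b := c₂) hc₁₂ hδ0
    (fun x hx => by
      rcases hx with ⟨h1, h2⟩ | ⟨h1, h2⟩
      · exact hreg_band (lo := c₁ - δ) (hi := c₁) le_rfl (by linarith) x (Or.inr ⟨h1, h2⟩)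
      · exact hreg_band (lo := c₂) (hi := c₂ + δ) (by linarith) le_rfl x (Or.inr ⟨h1, h2⟩))
    (fun x hx hc => absurd hc (hregband x
      (by rw [abs_of_pos (by linarith [hx.1])]; linarith [hx.1])
      (by rw [abs_of_pos (by linarith [hx.1])]; linarith [hx.2])))
  -- the collars have no critical points: their Morse counts vanish
  have hcount_zero : ∀ {a b : ℝ}, (∀ x, g x ∈ Ioo a b → ¬ IsMCriticalPt (𝓡 4) g x) →
      ∑ k ∈ Finset.range (3 + 2), (-1 : ℤ) ^ k *
        ((criticalSetOfIndex (𝓡 (3 + 1)) g k ∩ g ⁻¹' Ioo a b).ncard : ℤ) = 0 := by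
    intro a b hab
    refine Finset.sum_eq_zero fun k _ => ?_
    have hempty : criticalSetOfIndex (𝓡 (3 + 1)) g k ∩ g ⁻¹' Ioo a b = ∅ := by
      refine Set.eq_empty_iff_forall_notMem.2 fun x hx => ?_
      exact hab x hx.2 ((mem_criticalSetOfIndex (I := 𝓡 4)).1 hx.1).1
    rw [hempty, Set.ncard_empty]; simp
  have hχcol₁0 : relEuler ℤ ℤ ↥(g ⁻¹' Icc (-c₂) (-c₁)) (Subtype.val ⁻¹' (g ⁻¹' {-c₂})) = 0 := by
    rw [hχcol₁]
    exact hcount_zero fun x hx => hregband x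
      (by rw [abs_of_neg (by linarith [hx.2])]; linarith [hx.2])
      (by rw [abs_of_neg (by linarith [hx.2])]; linarith [hx.1])
  have hχcol₂0 : relEuler ℤ ℤ ↥(g ⁻¹' Icc c₁ c₂) (Subtype.val ⁻¹' (g ⁻¹' {c₁})) = 0 := by
    rw [hχcol₂]
    exact hcount_zero fun x hx => hregband x
      (by rw [abs_of_pos (by linarith [hx.1])]; linarith [hx.1])
      (by rw [abs_of_pos (by linarith [hx.1])]; linarith [hx.2])
  -- the levels `-c₂` and `c₁`
  obtain ⟨hlev₁, hχlev₁⟩ := finRelHomology_and_relEuler_level hg (a := -c₂) fun x hx =>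
    hregband x (by rw [hx, abs_neg, abs_of_pos hc₂0]; linarith)
      (by rw [hx, abs_neg, abs_of_pos hc₂0]; exact hc₂M)
  obtain ⟨hlev₂, hχlev₂⟩ := finRelHomology_and_relEuler_level hg (a := c₁) fun x hx =>
    hregband x (by rw [hx, abs_of_pos hc₁0]; exact hbc)
      (by rw [hx, abs_of_pos hc₁0]; linarith)
  -- absolute homology of the three slabs
  obtain ⟨hslabA, hχslabA⟩ := finRelHomology_and_relEuler_slab_abs (g := g) (by linarith) hslab
    (hlev₁.mono (by norm_num)) hχlev₁
  obtain ⟨hcol₁A, hχcol₁A⟩ := finRelHomology_and_relEuler_slab_abs (g := g) (by linarith) hcol₁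
    (hlev₁.mono (by norm_num)) hχlev₁
  obtain ⟨hcol₂A, hχcol₂A⟩ := finRelHomology_and_relEuler_slab_abs (g := g) hc₁₂.le hcol₂
    (hlev₂.mono (by norm_num)) hχlev₂
  rw [hχcol₁0] at hχcol₁A
  rw [hχcol₂0] at hχcol₂A
  -- Mayer–Vietoris in `B = {-c₂ ≤ g}` for the slab and the upper cap piece
  set B : Set X := g ⁻¹' Ici (-c₂) with hBdef
  have hS₁B : g ⁻¹' Icc (-c₂) c₂ ⊆ B := fun x hx => hx.1
  have hS₂B : g ⁻¹' Ici c₁ ⊆ B := fun x hx => by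
    have hx' : c₁ ≤ g x := hx
    show -c₂ ≤ g x
    linarith
  have hS₁₂ : g ⁻¹' Icc (-c₂) c₂ ∩ g ⁻¹' Ici c₁ = g ⁻¹' Icc c₁ c₂ := by
    ext x
    simp only [mem_inter_iff, mem_preimage, mem_Icc, mem_Ici]
    constructor
    · rintro ⟨⟨-, h2⟩, h3⟩; exact ⟨h3, h2⟩
    · rintro ⟨h1, h2⟩; exact ⟨⟨by linarith, h2⟩, h1⟩
  have hS₁₂B : g ⁻¹' Icc (-c₂) c₂ ∩ g ⁻¹' Ici c₁ ⊆ B := fun x hx => hS₁B hx.1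
  obtain ⟨e₁⟩ := nonempty_homeomorph_preimage_val hS₁B
  obtain ⟨e₂⟩ := nonempty_homeomorph_preimage_val hS₂B
  obtain ⟨e₁₂⟩ := nonempty_homeomorph_preimage_val hS₁₂B
  have hcovB : interior (Subtype.val ⁻¹' (g ⁻¹' Icc (-c₂) c₂) : Set ↥B) ∪
      interior (Subtype.val ⁻¹' (g ⁻¹' Ici c₁) : Set ↥B) = univ := by
    refine eq_univ_of_forall fun z => ?_
    by_cases hz : g (z : X) < c₂
    · left
      rw [mem_interior_iff_mem_nhds]
      refine Filter.mem_of_superset (((isOpen_Iio.preimage hgc).preimage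
        continuous_subtype_val).mem_nhds (show g (z : X) < c₂ from hz)) fun w hw => ?_
      exact ⟨z.2 |> fun _ => w.2, (show g (w : X) < c₂ from hw).le⟩
    · right
      rw [mem_interior_iff_mem_nhds]
      refine Filter.mem_of_superset (((isOpen_Ioi.preimage hgc).preimage
        continuous_subtype_val).mem_nhds (show c₁ < g (z : X) by push Not at hz; linarith))
        fun w hw => ?_
      exact (show c₁ < g (w : X) from hw).le
  have hU₁ : FinRelHomology ℤ ℤ ↥(Subtype.val ⁻¹' (g ⁻¹' Icc (-c₂) c₂) : Set ↥B) ∅ 5 :=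
    hslabA.of_homeomorph e₁.symm (mapsTo_empty _ _) (mapsTo_empty _ _)
  have hU₂ : FinRelHomology ℤ ℤ ↥(Subtype.val ⁻¹' (g ⁻¹' Ici c₁) : Set ↥B) ∅ 5 :=
    (hcap₁'.mono (by norm_num)).of_homeomorph e₂.symm (mapsTo_empty _ _) (mapsTo_empty _ _)
  have hU₁₂ : FinRelHomology ℤ ℤ
      ↥((Subtype.val ⁻¹' (g ⁻¹' Icc (-c₂) c₂) : Set ↥B) ∩ Subtype.val ⁻¹' (g ⁻¹' Ici c₁)) ∅ 5 :=
    (hcol₂A.of_homeomorph (Homeomorph.setCongr hS₁₂).symm (mapsTo_empty _ _)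
      (mapsTo_empty _ _)).of_homeomorph e₁₂.symm (mapsTo_empty _ _) (mapsTo_empty _ _)
  obtain ⟨hBfin, hχB⟩ := finRelHomology_of_interior_cover ℤ ℤ hcovB hU₁ hU₂ hU₁₂
  have hχU₁ : relEuler ℤ ℤ ↥(Subtype.val ⁻¹' (g ⁻¹' Icc (-c₂) c₂) : Set ↥B) ∅ =
      relEuler ℤ ℤ ↥(g ⁻¹' Icc (-c₂) c₂) ∅ :=
    relEuler_eq_of_homeomorph (R := ℤ) (M := ℤ) (A := (∅ : Set _)) e₁ (mapsTo_empty _ _)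
      (mapsTo_empty _ _)
  have hχU₂ : relEuler ℤ ℤ ↥(Subtype.val ⁻¹' (g ⁻¹' Ici c₁) : Set ↥B) ∅ =
      relEuler ℤ ℤ ↥(g ⁻¹' Ici c₁) ∅ :=
    relEuler_eq_of_homeomorph (R := ℤ) (M := ℤ) (A := (∅ : Set _)) e₂ (mapsTo_empty _ _)
      (mapsTo_empty _ _)
  have hχU₁₂ : relEuler ℤ ℤ
      ↥((Subtype.val ⁻¹' (g ⁻¹' Icc (-c₂) c₂) : Set ↥B) ∩ Subtype.val ⁻¹' (g ⁻¹' Ici c₁)) ∅ =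
      relEuler ℤ ℤ ↥(g ⁻¹' Icc c₁ c₂) ∅ :=
    (relEuler_eq_of_homeomorph (R := ℤ) (M := ℤ) (A := (∅ : Set _)) (B := (∅ : Set _)) e₁₂
      (mapsTo_empty _ _) (mapsTo_empty _ _)).trans
      (relEuler_eq_of_homeomorph (R := ℤ) (M := ℤ) (A := (∅ : Set _)) (B := (∅ : Set _))
        (Homeomorph.setCongr hS₁₂) (mapsTo_empty _ _) (mapsTo_empty _ _))
  -- Mayer–Vietoris in `X` for the lower cap piece and `B`
  have hAB : g ⁻¹' Iic (-c₁) ∩ B = g ⁻¹' Icc (-c₂) (-c₁) := by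
    ext x
    simp only [mem_inter_iff, mem_preimage, mem_Iic, mem_Icc, hBdef, mem_Ici]
    exact ⟨fun h' => ⟨h'.2, h'.1⟩, fun h' => ⟨h'.2, h'.1⟩⟩
  have hcovX : interior (g ⁻¹' Iic (-c₁)) ∪ interior B = univ := by
    refine eq_univ_of_forall fun x => ?_
    by_cases hx : g x < -c₁
    · left
      rw [mem_interior_iff_mem_nhds]
      exact Filter.mem_of_superset ((isOpen_Iio.preimage hgc).mem_nhds hx) fun w hw =>
        show g w ≤ -c₁ from le_of_lt hw
    · right
      rw [mem_interior_iff_mem_nhds]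
      refine Filter.mem_of_superset ((isOpen_Ioi.preimage hgc).mem_nhds
        (show -c₂ < g x by push Not at hx; linarith)) fun w hw => ?_
      exact show -c₂ ≤ g w from le_of_lt hw
  have hA6 : FinRelHomology ℤ ℤ ↥(g ⁻¹' Iic (-c₁)) ∅ 6 := hcap₂'.mono (by norm_num)
  have hAB6 : FinRelHomology ℤ ℤ ↥(g ⁻¹' Iic (-c₁) ∩ B) ∅ 6 :=
    (hcol₁A.mono (by norm_num)).of_homeomorph (Homeomorph.setCongr hAB).symm (mapsTo_empty _ _)
      (mapsTo_empty _ _)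
  obtain ⟨-, hχX'⟩ := finRelHomology_of_interior_cover ℤ ℤ hcovX hA6 hBfin hAB6
  have hχAB : relEuler ℤ ℤ ↥(g ⁻¹' Iic (-c₁) ∩ B) ∅ = relEuler ℤ ℤ ↥(g ⁻¹' Icc (-c₂) (-c₁)) ∅ :=
    relEuler_eq_of_homeomorph (R := ℤ) (M := ℤ) (A := (∅ : Set _)) (Homeomorph.setCongr hAB)
      (mapsTo_empty _ _) (mapsTo_empty _ _)
  -- the count
  have hχslab' : relEuler ℤ ℤ ↥(g ⁻¹' Icc (-c₂) c₂) (Subtype.val ⁻¹' (g ⁻¹' {-c₂})) =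
      ∑ k ∈ Finset.range 5, (-1 : ℤ) ^ k *
        ((criticalSetOfIndex (𝓡 4) g k ∩ g ⁻¹' Ioo (-c₂) c₂).ncard : ℤ) := hχslab
  rw [← hχslab']
  rw [hχX, hχAB, hχcol₁A] at hχX'
  rw [hχU₁, hχU₂, hχU₁₂, hχslabA, hχcol₂A, hχcap₁'] at hχB
  rw [hχcap₂'] at hχX'
  linarith

end IsSimplifiedBrokenLefschetzFibration

/-! ### Baykur's Lemma 7 on a homotopy 4-sphere -/

open IsSimplifiedBrokenLefschetzFibration in
/-- **Discharge of `card_eq_four_mul_of_sblf_of_homotopyEquiv_sphere_four`** (Baykur 2012,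
Lemma 7, on a homotopy 4-sphere): a genus-`(h+1)` simplified broken Lefschetz fibration of a
`C^∞` 4-manifold homotopy equivalent to `S⁴` has exactly `4h` Lefschetz critical points.
Proof: `χ(X) = 2` (`relEuler_eq_two_of_homotopyEquiv_sphere_four`); normalise the round image
to the equator (`exists_image_round_eq_sphereEquator`); choose `ε ∈ (0, 1)` off the finitely
many slopes `± v₀/v₂` of the Lefschetz values, so that no Lefschetz value is a pole of `Λ_{±ε}`;
then the Morse counts of `Λ_ε ∘ f` and `Λ_{-ε} ∘ f` between the caps are both `4h`
(`morseCount_height_eq_four_mul`) and add up to `2 #L`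
(`morseCount_height_add_morseCount_height_neg`). [cite: Baykur2012, Lemma 7] -/
theorem card_eq_four_mul_of_sblf_of_homotopyEquiv_sphere_four_holds :
    card_eq_four_mul_of_sblf_of_homotopyEquiv_sphere_four := by
  intro X _ _ _ _ _ e o f₀ L h hf₀
  haveI : CompactSpace X := compactSpace_of_homotopyEquiv_sphere_four_holds X e
  have hχX : relEuler ℤ ℤ X ∅ = 2 := relEuler_eq_two_of_homotopyEquiv_sphere_four e
  -- normalise the round image
  obtain ⟨f, hf, hC⟩ := hf₀.exists_image_round_eq_sphereEquator
  -- the slopes to avoid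
  classical
  set bad : Finset ℝ :=
    (L.image fun p => ((f p : Metric.sphere (0 : EuclideanSpace ℝ (Fin 3)) 1) :
        EuclideanSpace ℝ (Fin 3)) 0 /
      ((f p : Metric.sphere (0 : EuclideanSpace ℝ (Fin 3)) 1) : EuclideanSpace ℝ (Fin 3)) 2) ∪
    (L.image fun p => -(((f p : Metric.sphere (0 : EuclideanSpace ℝ (Fin 3)) 1) :
        EuclideanSpace ℝ (Fin 3)) 0 /
      ((f p : Metric.sphere (0 : EuclideanSpace ℝ (Fin 3)) 1) : EuclideanSpace ℝ (Fin 3)) 2))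
    with hbad
  obtain ⟨ε, ⟨hε0, hε1⟩, hεbad⟩ := (Ioo_infinite (zero_lt_one' ℝ)).exists_notMem_finset bad
  have hε : ε ≠ 0 := hε0.ne'
  -- the two heights
  set Λ₁ : EuclideanSpace ℝ (Fin 3) →L[ℝ] ℝ :=
    EuclideanSpace.proj (2 : Fin 3) + ε • EuclideanSpace.proj (0 : Fin 3) with hΛ₁def
  set Λ₂ : EuclideanSpace ℝ (Fin 3) →L[ℝ] ℝ :=
    EuclideanSpace.proj (2 : Fin 3) + (-ε) • EuclideanSpace.proj (0 : Fin 3) with hΛ₂def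
  have hΛ₁ : ∀ x, Λ₁ x = x 2 + ε * x 0 := fun x => by simp [hΛ₁def]
  have hΛ₂ : ∀ x, Λ₂ x = x 2 + (-ε) * x 0 := fun x => by simp [hΛ₂def]
  -- no Lefschetz value is a pole of `Λ_{±ε}`: `|Λ (f p)| < √(1 + ε²)`
  have hpole : ∀ (ε' : ℝ) (Λ' : EuclideanSpace ℝ (Fin 3) →L[ℝ] ℝ), (∀ x, Λ' x = x 2 + ε' * x 0) →
      ∀ v : Metric.sphere (0 : EuclideanSpace ℝ (Fin 3)) 1, (Λ' v) ^ 2 = 1 + ε' ^ 2 →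
        (v : EuclideanSpace ℝ (Fin 3)) 2 ≠ 0 ∧
        (v : EuclideanSpace ℝ (Fin 3)) 0 / (v : EuclideanSpace ℝ (Fin 3)) 2 = ε' := by
    intro ε' Λ' hΛ' v hv
    obtain ⟨n, hn, hnn⟩ := exists_inner_repr_height Λ' hΛ'
    have hn2 : n 2 = 1 := by
      rw [apply_eq_inner_single, real_inner_comm, ← hn, hΛ']; simp
    have hn0 : n 0 = ε' := by
      rw [apply_eq_inner_single, real_inner_comm, ← hn, hΛ']; simp
    have hvn : ‖(v : EuclideanSpace ℝ (Fin 3))‖ = 1 := norm_eq_of_mem_sphere v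
    -- `⟪n, v⟫ = ±‖n‖`, so `v = ±n/‖n‖`
    have hpar : ∀ u : EuclideanSpace ℝ (Fin 3), ‖u‖ = 1 → ⟪n, u⟫ = ‖n‖ →
        u 2 ≠ 0 ∧ u 0 / u 2 = ε' := by
      intro u hu hinner
      have h1 : ‖u‖ • n = ‖n‖ • u := by
        rw [← inner_eq_norm_mul_iff_real, hinner, hu, mul_one]
      rw [hu, one_smul] at h1
      have hnpos : 0 < ‖n‖ := by
        have : 0 < ‖n‖ ^ 2 := by rw [hnn]; positivity
        rcases (norm_nonneg n).lt_or_eq with h' | h'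
        · exact h'
        · rw [← h'] at this; norm_num at this
      have h2 : (1 : ℝ) = ‖n‖ * u 2 := by
        have := congrArg (fun x : EuclideanSpace ℝ (Fin 3) => x 2) h1
        simpa [hn2] using this
      have h0 : ε' = ‖n‖ * u 0 := by
        have := congrArg (fun x : EuclideanSpace ℝ (Fin 3) => x 0) h1
        simpa [hn0] using this
      have hu2 : u 2 ≠ 0 := by
        intro h'; rw [h', mul_zero] at h2; exact one_ne_zero h2
      refine ⟨hu2, ?_⟩
      rw [div_eq_iff hu2, h0, mul_comm (‖n‖) (u 0), mul_assoc, ← h2, mul_one]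
    have hsq : (Λ' v) ^ 2 = ‖n‖ ^ 2 := by rw [hv, hnn]
    rcases sq_eq_sq_iff_eq_or_eq_neg.1 hsq with hpos | hneg
    · rw [hn] at hpos
      exact hpar _ hvn hpos
    · have hneg' : ⟪n, -(v : EuclideanSpace ℝ (Fin 3))⟫ = ‖n‖ := by
        rw [inner_neg_right, ← hn, hneg, neg_neg]
      obtain ⟨h2, h02⟩ := hpar _ (by rw [norm_neg, hvn]) hneg'
      simp only [PiLp.neg_apply, ne_eq, neg_eq_zero, neg_div_neg_eq] at h2 h02
      exact ⟨h2, h02⟩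
  have hL₁ : ∀ p ∈ L, (Λ₁ (f p)) ^ 2 ≠ 1 + ε ^ 2 := by
    intro p hp hsq
    obtain ⟨-, hslope⟩ := hpole ε Λ₁ hΛ₁ (f p) hsq
    refine hεbad (Finset.mem_union_left _ (Finset.mem_image.2 ⟨p, hp, hslope⟩))
  have hL₂ : ∀ p ∈ L, (Λ₂ (f p)) ^ 2 ≠ 1 + (-ε) ^ 2 := by
    intro p hp hsq
    obtain ⟨-, hslope⟩ := hpole (-ε) Λ₂ hΛ₂ (f p) hsq
    refine hεbad (Finset.mem_union_right _ (Finset.mem_image.2 ⟨p, hp, ?_⟩))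
    rw [hslope, neg_neg]
  -- `|Λ (f p)| < M := √(1 + ε²)` for the Lefschetz points, and `|ε| < M`
  set M : ℝ := Real.sqrt (1 + ε ^ 2) with hMdef
  have hM0 : 0 < M := Real.sqrt_pos.2 (by positivity)
  have hMsq : M ^ 2 = 1 + ε ^ 2 := Real.sq_sqrt (by positivity)
  have hlt_of : ∀ t : ℝ, t ^ 2 ≤ 1 + ε ^ 2 → t ^ 2 ≠ 1 + ε ^ 2 → |t| < M := by
    intro t h1 h2
    have h3 : t ^ 2 < M ^ 2 := by rw [hMsq]; exact lt_of_le_of_ne h1 h2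
    exact abs_lt_of_sq_lt_sq h3 hM0.le
  have hsq_le : ∀ (ε' : ℝ) (Λ' : EuclideanSpace ℝ (Fin 3) →L[ℝ] ℝ), (∀ x, Λ' x = x 2 + ε' * x 0) →
      ∀ v : Metric.sphere (0 : EuclideanSpace ℝ (Fin 3)) 1, (Λ' v) ^ 2 ≤ 1 + ε' ^ 2 := by
    intro ε' Λ' hΛ' v
    obtain ⟨n, hn, hnn⟩ := exists_inner_repr_height Λ' hΛ'
    have h1 := abs_apply_le_norm_of_mem_sphere n Λ' hn v
    have h2 : |Λ' v| ^ 2 ≤ ‖n‖ ^ 2 := pow_le_pow_left₀ (abs_nonneg _) h1 2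
    rwa [sq_abs, hnn] at h2
  have hεM : |ε| < M := by
    refine hlt_of ε (by linarith [sq_nonneg ε]) (by linarith)
  -- the common level data
  set vals : Finset ℝ := insert |ε|
    ((L.image fun p => |Λ₁ (f p)|) ∪ (L.image fun p => |Λ₂ (f p)|)) with hvals
  have hvals_ne : vals.Nonempty := Finset.insert_nonempty _ _
  set b' : ℝ := vals.max' hvals_ne with hb'def
  have hεb : |ε| ≤ b' := Finset.le_max' _ _ (Finset.mem_insert_self _ _)
  have hLb₁ : ∀ p ∈ L, |Λ₁ (f p)| ≤ b' := fun p hp =>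
    Finset.le_max' vals _ (Finset.mem_insert_of_mem
      (Finset.mem_union_left _ (Finset.mem_image_of_mem (fun p => |Λ₁ (f p)|) hp)))
  have hLb₂ : ∀ p ∈ L, |Λ₂ (f p)| ≤ b' := fun p hp =>
    Finset.le_max' vals _ (Finset.mem_insert_of_mem
      (Finset.mem_union_right _ (Finset.mem_image_of_mem (fun p => |Λ₂ (f p)|) hp)))
  have hb'M : b' < M := by
    have hmem := Finset.max'_mem vals hvals_ne
    rw [← hb'def, hvals, Finset.mem_insert, Finset.mem_union, Finset.mem_image,
      Finset.mem_image] at hmem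
    rcases hmem with h' | ⟨p, hp, h'⟩ | ⟨p, hp, h'⟩
    · rw [h']; exact hεM
    · rw [← h']; exact hlt_of _ (hsq_le ε Λ₁ hΛ₁ (f p)) (hL₁ p hp)
    · rw [← h']
      refine hlt_of _ ?_ ?_
      · have := hsq_le (-ε) Λ₂ hΛ₂ (f p); rwa [neg_sq] at this
      · have := hL₂ p hp; rwa [neg_sq] at this
  set c₁ : ℝ := (2 * b' + M) / 3 with hc₁
  set c₂ : ℝ := (b' + 2 * M) / 3 with hc₂
  have hbc : b' < c₁ := by rw [hc₁]; linarith
  have hc₁₂ : c₁ < c₂ := by rw [hc₁, hc₂]; linarith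
  have hc₂M : c₂ < M := by rw [hc₂]; linarith
  have hb'0 : 0 ≤ b' := (abs_nonneg ε).trans hεb
  have hc₂sq : c₂ ^ 2 < 1 + ε ^ 2 := by
    rw [← hMsq]; exact pow_lt_pow_left₀ hc₂M (by linarith) two_ne_zero
  -- the two counts are `4h` each and add up to `2 #L`
  have hN₁ := morseCount_height_eq_four_mul hf hC hχX hε Λ₁ hΛ₁ hεb hLb₁ hbc hc₁₂ hc₂sq
  have hN₂ := morseCount_height_eq_four_mul hf hC hχX (neg_ne_zero.2 hε) Λ₂ hΛ₂
    (by rwa [abs_neg]) hLb₂ hbc hc₁₂ (by rwa [neg_sq])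
  have hsum := morseCount_height_add_morseCount_height_neg hf hC hε Λ₁ Λ₂ hΛ₁ hΛ₂
    (hεb.trans_lt (hbc.trans hc₁₂)) hc₂sq
    (fun p hp => (hLb₁ p hp).trans_lt (hbc.trans hc₁₂))
    (fun p hp => (hLb₂ p hp).trans_lt (hbc.trans hc₁₂))
  -- the index-`5` terms vanish (`index ≤ dim = 4`)
  have h5 : ∀ (Λ' : EuclideanSpace ℝ (Fin 3) →L[ℝ] ℝ),
      criticalSetOfIndex (𝓡 4)
          ((fun w : Metric.sphere (0 : EuclideanSpace ℝ (Fin 3)) 1 => Λ' w) ∘ f) 5 = ∅ := by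
    intro Λ'
    refine Set.eq_empty_iff_forall_notMem.2 fun x hx => ?_
    have hle := morseIndex_le_finrank (I := 𝓡 4)
      (f := (fun w : Metric.sphere (0 : EuclideanSpace ℝ (Fin 3)) 1 => Λ' w) ∘ f) (x := x)
    rw [((mem_criticalSetOfIndex (I := 𝓡 4)).1 hx).2, finrank_euclideanSpace_fin] at hle
    omega
  rw [Finset.sum_range_succ, Finset.sum_range_succ _ 5, h5 Λ₁, h5 Λ₂, Set.empty_inter,
    Set.empty_inter, Set.ncard_empty, hN₁, hN₂] at hsum
  push_cast at hsum
  have : (L.card : ℤ) = 4 * h := by linarith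
  exact_mod_cast this

end Literature.Topology.FourManifolds
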